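import Mathlib
import Literature.MathematicalPhysics.QuantumFieldTheory.Balaban1983to89.Beta.CombesThomasForm

/-!
# Beta/CombesThomasFormOp — the form-version Combes–Thomas estimate in OPERATOR (weighted `ℓ²`) form:
set-to-set decay of `H⁻¹` with constants that do not see the lattice spacing

HONEST FRAMING (verbatim, page 1 of everything this cell writes): discharging `BetaPertH` makes Bałaban's UV
stability UNCONDITIONAL — a real constructive-QFT result; it is NOT the continuum limit and NOT the Clay problem.
Gloss (BETA-SPEC v1.9b l. 17–18, G-ref2-14 (a) / G-ref2-20 (a), verbatim): «UNCONDITIONAL» in [Balaban1989LargeFieldII]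
(B16, CMP 122) p. 355's interval-hypothesis sense ONLY (`FlowStepRuns.p355Unconditional_of_partialSums` keeps `hnodes`);
the located leaves G-adv3-2 (left inequality of (0.1)/(2.50), d = 4), G-adv3-1 (U2 transfer of B14 Cor. 3's lower
bound) and `SecondExpLeaf` REMAIN.  Gloss 2 (BETA-SPEC v1.9e 22:38Z, beta-ref C-beta-78, BINDING, verbatim): «UNCONDITIONAL» =
`Beta.Assembly.EventualForm`-unconditional — the END statement with the interval hypothesis removed, (0.31) in DEFECTED form
on all lattices (`PrefixAbsorption.thm2Defected_of_eventualForm`), admissible couplings shrunk to g ≤ g⋆; NOT «B12 Theorem 2 as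
printed» (that needs (AF-0s) or (AF-0-L) ∀k at L ≥ L₁ in addition: `eventualForm_not_thm2Printed`, RULING (R6)); never the
continuum limit / mass gap / Clay.  THIS MODULE discharges nothing of that and makes NO UV-stability claim at all: it
is a Mathlib-elementary kernel certificate (v1.0.1/v1.0.2 = v1 + this paragraph, docstring-only — beta-ref R129/R150,
ref2 G-ref2-20 (a); no declaration changed).

SCOPE.  This module belongs to the audit package of T. Bałaban's lattice Yang–Mills programme
(cell `pub-balaban`).  It is ELEMENTARY FINITE-DIMENSIONAL LINEAR ALGEBRA (folklore; Combes–Thomas 1973), proved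
from Mathlib and the landed sibling `Beta/CombesThomasForm` alone; it quotes nothing from the manuscripts under audit
inside a theorem and asserts nothing about them.  It is NOT summit progress, NOT the continuum limit, NOT the Clay
problem.

WHY THIS FILE (cell census G-pv23g3-3, the cross-read of `Beta/CombesThomasForm`).  The sibling module proves the
Combes–Thomas estimate in quadratic-form version — `combesThomas_form`: coercivity `σ‖ω‖² ≤ ⟨ω, Hω⟩` plus a
form bound `−(σ/2)‖w‖²` on the conjugation error of an arbitrary weight `φ` — but draws from it only the POINT-SOURCE
conclusion `|H⁻¹(i, k₀)| ≤ (2/σ) e^{−(φ_i − φ_{k₀})}`.  In the intended instantiation (fine torus of mesh `η = 1/n` in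
counting coordinates, `H` = the matrix of `Δ^η + aQ*Q`, Bałaban's kernel `G₀(x, x′) = η^{−d} (H⁻¹)_{xx′}`) an
ENTRYWISE bound `|(H⁻¹)_{xx′}| ≤ C e^{−δ·dist}` yields cube-to-cube norms of the type printed in
[Balaban1984PropagatorsI] Prop. 1.2 — (1.110) p. 35 (`L^∞`) and (1.114) p. 36 (`L²`), both with constants «depending
on d only» and NO power of `η` — only with constants `(2n)^d · C` (row sums over a cube of `n^d` points; Schur /
Hilbert–Schmidt), i.e. NOT uniformly in the spacing.  What is uniform is the OPERATOR form of the same argument: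
for EVERY right-hand side `g`,
  `‖e^{φ} H⁻¹ g‖_{ℓ²} ≤ (2/σ) ‖e^{φ} g‖_{ℓ²}`
(with `w = e^{φ} H⁻¹ g` one has `Σ_{j,k} e^{φ_j − φ_k} H_{jk} w_j w_k = ⟨w, e^{φ} g⟩ ≤ ‖w‖ ‖e^{φ}g‖`, and the left side
is `⟨w, Hw⟩ + error ≥ (σ/2)‖w‖²`).  Consequently, for `g` supported in a set `T` and any set `S`,
  `(Σ_{i ∈ S} (H⁻¹ g)_i²)^{1/2} ≤ (2/σ) e^{−(inf_S φ − sup_T φ)} ‖g‖_{ℓ²}`,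
which is the `ℓ² → ℓ²` operator-norm bound `‖1_S H⁻¹ 1_T‖ ≤ (2/σ) e^{−(inf_S φ − sup_T φ)}`.  Since the `η^d`-weighted
`L²(T_η)` norm is `η^{d/2}` times the counting `ℓ²` norm on both sides, this IS `‖1_S G₀ 1_T‖_{L²(T_η) → L²(T_η)}` in
Bałaban's normalisation: a (1.114)-type cube-to-cube decay of `G₀ = (Δ^η + aQ*Q)⁻¹` with constants depending on
`(σ, δ, Θ)` only — for every mesh, once the torus instance and the all-`n` Poincaré bound `σ(d, a)` are supplied (typing
work outside this file, as for the sibling).  The `L^∞`-type bound (1.110) is NOT obtained from Combes–Thomas alone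
(the trivial `ℓ² → ℓ^∞` step costs `n^{d/2}`); it needs a local-regularity input of the type of [Balaban1984PropagatorsI]
(1.115)/(1.89), which is not in this file.

THE ROUTE IS THE ONE THE PAPER NAMES AND DOES NOT TAKE ([Balaban1984PropagatorsI] p. 36, verbatim from the page image):
«Probably the simplest proof of the exponential decay properties can be obtained by relating G on the torus to G on
the whole lattice ηZ^d in the usual way, and then proving that the operator e^{−⟨q,x⟩}Δ_a e^{⟨q,x⟩} − Δ_a is a small
perturbation of Δ_a for vectors q∈R^d sufficiently small.  Instead we construct a random walk representation of the
kind described in [2].»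

CONTENTS (all PROVED, 0 sorry; one definition `distTo`; imports Mathlib and the landed `Beta/CombesThomasForm`, whose graph
Laplacian `lap` and defect lemmas `conjError_lap_ge`, `conjError_blocks_ge`, `lapDefect_le`, `blockDefect_le` are
reused, not re-proved).
§1 `combesThomas_form_op` — the operator form: under the two hypotheses of `combesThomas_form`, for every `g` and every
   solution of `Hv = g`: `Σ_j (e^{φ_j} v_j)² ≤ (2/σ)² Σ_j (e^{φ_j} g_j)²`.
§2 `weightedSq_le_of_support` (bookkeeping: `supp g ⊆ T`, `φ ≤ hi` on `T` ⇒ `Σ (e^{φ}g)² ≤ e^{2hi} Σ g²`),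
   `setSq_le_of_weightedSq` (`lo ≤ φ` on `S` ⇒ `Σ_{i∈S} v_i² ≤ e^{−2lo} Σ (e^{φ}v)²`), and
   **`setDecay_form_op`** — `supp g ⊆ T`, `lo ≤ φ|_S`, `φ|_T ≤ hi` ⇒
   `Σ_{i∈S} v_i² ≤ (2/σ)² e^{−2(lo − hi)} Σ_j g_j²` (the `ℓ² → ℓ²` set-to-set bound).
§3 `conjError_lap_add_blocks_ge` — the conjugation error of `H = lap c + Σ_b m_b u_b ⊗ u_b` is `≥ −(κΔ + κQ)‖w‖²`
   (the two sibling defect lemmas added up); `setDecay_lap_add_blocks` — the assembly in operator form.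
§4 **`setDecay_lattice`** — the lattice shape `Δ^η + aQ*Q`: bond coefficients `η⁻²` on `≤ z` neighbours, weight
   oscillation `≤ δη ≤ 1` across bonds and `≤ Θ` on blocks, block strengths `m_b‖u_b‖² ≤ a`, coercivity `σ`, and the
   smallness condition `z δ² + a (e^Θ − 1) ≤ σ/2` in which `η` DOES NOT APPEAR ⇒ the set-to-set bound of §2 for every
   right-hand side: the (1.114)-type statement, uniformly in the mesh.  `pointwise_of_setDecay` records that the
   sibling's point-source bound is the special case `S = {i}`, `T = {k₀}`, `g = e_{k₀}`.
§5 `distTo` (distance to the source set along a supplied distance function; `1`-Lipschitz: `abs_distTo_sub_le`) and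
   **`setDecay_lattice_dist`** — §4 with the weight `φ = δ·distTo d T` built in, so that an instantiator supplies only
   metric facts (bonds of `d`-length `≤ η`, blocks of `d`-diameter `≤ D`, `S` at `d`-distance `≥ R` from `T`):
   `Σ_{i∈S} (H⁻¹g)_i² ≤ (2/σ)² e^{−2δR} Σ_j g_j²` under `z δ² + a (e^{δD} − 1) ≤ σ/2`.

References: J.-M. Combes, L. Thomas, Commun. Math. Phys. 34 (1973) 251–270 [CombesThomas1973]; T. Bałaban, Commun.
Math. Phys. 95 (1984) 17–40 [Balaban1984PropagatorsI] (context only: Prop. 1.2 (1.110) p. 35, (1.114) p. 36, and the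
sentence quoted above, p. 36; renders `HOME/b2b-balaban-ref1/pages/1984-cmp95-propagators-rt-I/…-p019-x2.png`,
`…-p020-x2.png` read as images).  Unit `b2b-balaban-pv23-g3` (surge node prover #23, gen 3; journal claim
BETA-CT-OPFORM-KERNEL); census rows GAPS G-pv23g3-3 (the located objection this file repairs on the kernel side),
C-pv23g3-2; staged byte-identically under `HOME/lean/BalabanYm4/`.  NOT summit progress.
-/

namespace Literature.MathematicalPhysics.QuantumFieldTheory.Balaban1983to89.Beta.CombesThomasFormOp

open Finset Matrix
open Literature.MathematicalPhysics.QuantumFieldTheory.Balaban1983to89.Beta.CombesThomasForm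

variable {n : Type*} [Fintype n]

/-! ## §1  The operator (weighted `ℓ²`) form -/

/-- **Combes–Thomas, form version, OPERATOR form.**  `H` a real matrix with `σ‖ω‖² ≤ ⟨ω, Hω⟩` (`σ > 0`) and `φ` any
weight whose conjugation error is form-bounded, `−(σ/2)‖w‖² ≤ Σ_{j,k} (e^{φ_j − φ_k} − 1) H_jk w_j w_k` for all `w`
(the two hypotheses of the sibling `combesThomas_form`).  Then for EVERY right-hand side `g` and every solution of
`H v = g`: `Σ_j (e^{φ_j} v_j)² ≤ (2/σ)² Σ_j (e^{φ_j} g_j)²`, i.e. `‖e^{φ} H⁻¹ g‖ ≤ (2/σ) ‖e^{φ} g‖`.  Proof: with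
`w_j = e^{φ_j} v_j`, `Σ_{j,k} e^{φ_j − φ_k} H_jk w_j w_k = Σ_j w_j e^{φ_j} (Hv)_j = ⟨w, e^{φ} g⟩ ≤ ‖w‖ ‖e^{φ} g‖`
(Cauchy–Schwarz), while the left side is `⟨w, Hw⟩ + error ≥ (σ/2)‖w‖²`. [cite: CombesThomas1973, §II] [folklore] -/
theorem combesThomas_form_op (H : Matrix n n ℝ) (σ : ℝ) (φ : n → ℝ) (hσ : 0 < σ)
    (hpos : ∀ ω : n → ℝ, σ * (ω ⬝ᵥ ω) ≤ ω ⬝ᵥ H.mulVec ω)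
    (herr : ∀ w : n → ℝ,
      -(σ / 2) * (w ⬝ᵥ w) ≤ ∑ j, ∑ k, (Real.exp (φ j - φ k) - 1) * H j k * (w j * w k))
    (g v : n → ℝ) (hv : H.mulVec v = g) :
    ∑ j, (Real.exp (φ j) * v j) ^ 2 ≤ (2 / σ) ^ 2 * ∑ j, (Real.exp (φ j) * g j) ^ 2 := by
  set S : ℝ := ∑ j, (Real.exp (φ j) * v j) ^ 2 with hS
  set T : ℝ := ∑ j, (Real.exp (φ j) * g j) ^ 2 with hT
  set w : n → ℝ := fun j => Real.exp (φ j) * v j with hw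
  set G : n → ℝ := fun j => Real.exp (φ j) * g j with hG
  -- the conjugated equation: e^{φ_j} (Hv)_j = Σ_k e^{φ_j − φ_k} H_jk w_k
  have hEAv : ∀ j, Real.exp (φ j) * (H.mulVec v) j = ∑ k, Real.exp (φ j - φ k) * H j k * w k := by
    intro j
    simp only [mulVec, dotProduct, hw, Finset.mul_sum, Real.exp_sub]
    refine Finset.sum_congr rfl fun k _ => ?_
    field_simp
  have hlhs : ∑ j, w j * (Real.exp (φ j) * (H.mulVec v) j) = w ⬝ᵥ G := by
    simp only [hv, hG, dotProduct]
  have hsplit : ∑ j, w j * (Real.exp (φ j) * (H.mulVec v) j) =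
      w ⬝ᵥ H.mulVec w + ∑ j, ∑ k, (Real.exp (φ j - φ k) - 1) * H j k * (w j * w k) := by
    have h0 : ∑ j, w j * (Real.exp (φ j) * (H.mulVec v) j) =
        ∑ j, w j * ∑ k, Real.exp (φ j - φ k) * H j k * w k :=
      Finset.sum_congr rfl fun j _ => by rw [hEAv j]
    rw [h0]
    simp only [dotProduct, mulVec, Finset.mul_sum, ← Finset.sum_add_distrib]
    refine Finset.sum_congr rfl fun j _ => Finset.sum_congr rfl fun k _ => by ring
  have hS0 : 0 ≤ S := Finset.sum_nonneg fun j _ => sq_nonneg _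
  have hT0 : 0 ≤ T := Finset.sum_nonneg fun j _ => sq_nonneg _
  have hww : w ⬝ᵥ w = S := by
    simp only [dotProduct, hS, hw]; exact Finset.sum_congr rfl fun j _ => by ring
  -- (σ/2) S ≤ ⟨w, G⟩
  have hmain : σ / 2 * S ≤ w ⬝ᵥ G := by
    have h1 := hpos w
    have h2 := herr w
    rw [hww] at h1 h2
    linarith [hlhs, hsplit]
  -- Cauchy–Schwarz: ⟨w, G⟩² ≤ S T
  have hCS : (w ⬝ᵥ G) ^ 2 ≤ S * T := by
    have h := Finset.sum_mul_sq_le_sq_mul_sq univ w G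
    have e1 : w ⬝ᵥ G = ∑ i, w i * G i := rfl
    have e2 : S = ∑ i, w i ^ 2 := by
      simp only [hS, hw]
    have e3 : T = ∑ i, G i ^ 2 := by
      simp only [hT, hG]
    rw [e1, e2, e3]
    exact h
  -- conclude
  by_cases hS' : S = 0
  · rw [hS']; positivity
  · have hSpos : 0 < S := lt_of_le_of_ne hS0 (Ne.symm hS')
    have h1 : (σ / 2 * S) ^ 2 ≤ S * T := by
      calc (σ / 2 * S) ^ 2 ≤ (w ⬝ᵥ G) ^ 2 := pow_le_pow_left₀ (by positivity) hmain 2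
        _ ≤ S * T := hCS
    have h2 : (σ / 2) ^ 2 * S ≤ T := by
      have e : (σ / 2 * S) ^ 2 = ((σ / 2) ^ 2 * S) * S := by ring
      rw [e, mul_comm S T] at h1
      exact le_of_mul_le_mul_right h1 hSpos
    calc S = (2 / σ) ^ 2 * ((σ / 2) ^ 2 * S) := by field_simp
      _ ≤ (2 / σ) ^ 2 * T := mul_le_mul_of_nonneg_left h2 (by positivity)

/-! ## §2  Set-to-set decay (the `ℓ² → ℓ²` operator-norm bound between two index sets) -/

/-- Bookkeeping: if `g` vanishes off `T` and `φ ≤ hi` on `T` then `Σ_j (e^{φ_j} g_j)² ≤ e^{2hi} Σ_j g_j²`. [folklore] -/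
theorem weightedSq_le_of_support (φ g : n → ℝ) (T : Finset n) (hi : ℝ)
    (hg : ∀ j, j ∉ T → g j = 0) (hhi : ∀ j ∈ T, φ j ≤ hi) :
    ∑ j, (Real.exp (φ j) * g j) ^ 2 ≤ Real.exp (2 * hi) * ∑ j, g j ^ 2 := by
  rw [Finset.mul_sum]
  refine Finset.sum_le_sum fun j _ => ?_
  by_cases hj : j ∈ T
  · have h1 : Real.exp (φ j) ^ 2 ≤ Real.exp (2 * hi) := by
      rw [← Real.exp_nat_mul]
      exact Real.exp_le_exp.2 (by push_cast; linarith [hhi j hj])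
    calc (Real.exp (φ j) * g j) ^ 2 = Real.exp (φ j) ^ 2 * g j ^ 2 := by ring
      _ ≤ Real.exp (2 * hi) * g j ^ 2 := mul_le_mul_of_nonneg_right h1 (sq_nonneg _)
  · rw [hg j hj]; simp

/-- Bookkeeping: if `lo ≤ φ` on `S` then `Σ_{i∈S} v_i² ≤ e^{−2lo} Σ_j (e^{φ_j} v_j)²`. [folklore] -/
theorem setSq_le_of_weightedSq (φ v : n → ℝ) (S : Finset n) (lo : ℝ) (hlo : ∀ i ∈ S, lo ≤ φ i) :
    ∑ i ∈ S, v i ^ 2 ≤ Real.exp (-(2 * lo)) * ∑ j, (Real.exp (φ j) * v j) ^ 2 := by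
  calc ∑ i ∈ S, v i ^ 2 ≤ ∑ i ∈ S, Real.exp (-(2 * lo)) * (Real.exp (φ i) * v i) ^ 2 := by
        refine Finset.sum_le_sum fun i hi => ?_
        have h1 : (1 : ℝ) ≤ Real.exp (-(2 * lo)) * Real.exp (φ i) ^ 2 := by
          rw [← Real.exp_nat_mul, ← Real.exp_add]
          exact Real.one_le_exp (by push_cast; linarith [hlo i hi])
        calc v i ^ 2 = 1 * v i ^ 2 := (one_mul _).symm
          _ ≤ Real.exp (-(2 * lo)) * Real.exp (φ i) ^ 2 * v i ^ 2 :=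
            mul_le_mul_of_nonneg_right h1 (sq_nonneg _)
          _ = Real.exp (-(2 * lo)) * (Real.exp (φ i) * v i) ^ 2 := by ring
    _ = Real.exp (-(2 * lo)) * ∑ i ∈ S, (Real.exp (φ i) * v i) ^ 2 := by rw [Finset.mul_sum]
    _ ≤ Real.exp (-(2 * lo)) * ∑ j, (Real.exp (φ j) * v j) ^ 2 := by
        refine mul_le_mul_of_nonneg_left ?_ (Real.exp_pos _).le
        exact Finset.sum_le_sum_of_subset_of_nonneg (Finset.subset_univ S) fun j _ _ => sq_nonneg _

/-- **Set-to-set decay, operator form.**  Under the two hypotheses of `combesThomas_form` / `combesThomas_form_op`: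
if `g` is supported in `T`, `φ ≤ hi` on `T` and `lo ≤ φ` on `S`, then every solution of `Hv = g` satisfies
`Σ_{i∈S} v_i² ≤ (2/σ)² e^{−2(lo − hi)} Σ_j g_j²` — i.e. `‖1_S H⁻¹ 1_T‖_{ℓ²→ℓ²} ≤ (2/σ) e^{−(lo − hi)}`.  With
`φ = δ·dist(·, T)` truncated Lipschitz-wise this is the cube-to-cube decay `(2/σ) e^{−δ·dist(S,T)}`; the counting `ℓ²`
norm and Bałaban's `η^d`-weighted `L²(T_η)` norm differ by the same factor `η^{d/2}` on both sides, so the bound is the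
same in either normalisation. [cite: CombesThomas1973, §II] [folklore] -/
theorem setDecay_form_op (H : Matrix n n ℝ) (σ : ℝ) (φ : n → ℝ) (hσ : 0 < σ)
    (hpos : ∀ ω : n → ℝ, σ * (ω ⬝ᵥ ω) ≤ ω ⬝ᵥ H.mulVec ω)
    (herr : ∀ w : n → ℝ,
      -(σ / 2) * (w ⬝ᵥ w) ≤ ∑ j, ∑ k, (Real.exp (φ j - φ k) - 1) * H j k * (w j * w k))
    (S T : Finset n) (lo hi : ℝ) (hlo : ∀ i ∈ S, lo ≤ φ i) (hhi : ∀ j ∈ T, φ j ≤ hi)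
    (g v : n → ℝ) (hg : ∀ j, j ∉ T → g j = 0) (hv : H.mulVec v = g) :
    ∑ i ∈ S, v i ^ 2 ≤ (2 / σ) ^ 2 * Real.exp (-(2 * (lo - hi))) * ∑ j, g j ^ 2 := by
  have h1 := setSq_le_of_weightedSq φ v S lo hlo
  have h2 := combesThomas_form_op H σ φ hσ hpos herr g v hv
  have h3 := weightedSq_le_of_support φ g T hi hg hhi
  have hg0 : 0 ≤ ∑ j, g j ^ 2 := Finset.sum_nonneg fun j _ => sq_nonneg _
  have hexp : Real.exp (-(2 * (lo - hi))) = Real.exp (-(2 * lo)) * Real.exp (2 * hi) := by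
    rw [← Real.exp_add]; ring_nf
  calc ∑ i ∈ S, v i ^ 2 ≤ Real.exp (-(2 * lo)) * ∑ j, (Real.exp (φ j) * v j) ^ 2 := h1
    _ ≤ Real.exp (-(2 * lo)) * ((2 / σ) ^ 2 * (Real.exp (2 * hi) * ∑ j, g j ^ 2)) := by
        refine mul_le_mul_of_nonneg_left ?_ (Real.exp_pos _).le
        exact h2.trans (mul_le_mul_of_nonneg_left h3 (by positivity))
    _ = (2 / σ) ^ 2 * Real.exp (-(2 * (lo - hi))) * ∑ j, g j ^ 2 := by rw [hexp]; ring

/-! ## §3  Assembly: Laplacian + block projections, operator form -/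

/-- **Conjugation error of `H = lap c + Σ_b m_b u_b ⊗ u_b`** — the sibling's two defect lemmas added up: the error is
`≥ −(κΔ + κQ)‖w‖²`, `κΔ` bounding the Laplacian row defects `Σ_k c_jk (cosh(φ_j − φ_k) − 1)` and `κQ` the block
defects `m_b ε_b ‖u_b‖²`. [folklore] -/
theorem conjError_lap_add_blocks_ge [DecidableEq n] {β : Type*} [Fintype β] [DecidableEq β]
    (c : n → n → ℝ) (hc : ∀ j k, c j k = c k j) (hc0 : ∀ j k, 0 ≤ c j k)
    (blk : n → β) (m : β → ℝ) (hm : ∀ b, 0 ≤ m b) (u : β → n → ℝ) (hu : ∀ b j, blk j ≠ b → u b j = 0)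
    (H : Matrix n n ℝ) (hH : ∀ j k, H j k = lap c j k + ∑ b, m b * (u b j * u b k))
    (φ : n → ℝ) (κΔ κQ : ℝ) (hκΔ : ∀ j, ∑ k, c j k * (Real.cosh (φ j - φ k) - 1) ≤ κΔ)
    (ε : β → ℝ) (hε0 : ∀ b, 0 ≤ ε b)
    (hε : ∀ b j k, blk j = b → blk k = b → |Real.exp (φ j - φ k) - 1| ≤ ε b)
    (hκQ : ∀ b, m b * ε b * ∑ k, u b k ^ 2 ≤ κQ) (w : n → ℝ) :
    -(κΔ + κQ) * (w ⬝ᵥ w) ≤ ∑ j, ∑ k, (Real.exp (φ j - φ k) - 1) * H j k * (w j * w k) := by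
  have h1 := conjError_lap_ge c hc hc0 φ κΔ hκΔ w
  have h2 := conjError_blocks_ge blk m hm u hu φ ε hε0 hε κQ hκQ w
  have hsplit : ∑ j, ∑ k, (Real.exp (φ j - φ k) - 1) * H j k * (w j * w k)
      = ∑ j, ∑ k, (Real.exp (φ j - φ k) - 1) * lap c j k * (w j * w k)
        + ∑ j, ∑ k, (Real.exp (φ j - φ k) - 1) * (∑ b, m b * (u b j * u b k)) * (w j * w k) := by
    rw [← Finset.sum_add_distrib]
    refine Finset.sum_congr rfl fun j _ => ?_
    rw [← Finset.sum_add_distrib]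
    exact Finset.sum_congr rfl fun k _ => by rw [hH j k]; ring
  rw [hsplit]
  linarith

/-- **Set-to-set decay for `H = lap c + Σ_b m_b u_b ⊗ u_b`** (the shape of `Δ^η + aQ*Q`), operator form: coercivity
`σ`, defects `κΔ + κQ ≤ σ/2` ⇒ for `g` supported in `T`, `φ ≤ hi` on `T`, `lo ≤ φ` on `S`, every solution of
`Hv = g` obeys `Σ_{i∈S} v_i² ≤ (2/σ)² e^{−2(lo − hi)} Σ_j g_j²`. [cite: CombesThomas1973, §II] [folklore] -/
theorem setDecay_lap_add_blocks [DecidableEq n] {β : Type*} [Fintype β] [DecidableEq β]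
    (c : n → n → ℝ) (hc : ∀ j k, c j k = c k j) (hc0 : ∀ j k, 0 ≤ c j k)
    (blk : n → β) (m : β → ℝ) (hm : ∀ b, 0 ≤ m b) (u : β → n → ℝ) (hu : ∀ b j, blk j ≠ b → u b j = 0)
    (H : Matrix n n ℝ) (hH : ∀ j k, H j k = lap c j k + ∑ b, m b * (u b j * u b k))
    (σ : ℝ) (hσ : 0 < σ) (hpos : ∀ ω : n → ℝ, σ * (ω ⬝ᵥ ω) ≤ ω ⬝ᵥ H.mulVec ω)
    (φ : n → ℝ) (κΔ κQ : ℝ) (hκΔ : ∀ j, ∑ k, c j k * (Real.cosh (φ j - φ k) - 1) ≤ κΔ)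
    (ε : β → ℝ) (hε0 : ∀ b, 0 ≤ ε b)
    (hε : ∀ b j k, blk j = b → blk k = b → |Real.exp (φ j - φ k) - 1| ≤ ε b)
    (hκQ : ∀ b, m b * ε b * ∑ k, u b k ^ 2 ≤ κQ) (hsmall : κΔ + κQ ≤ σ / 2)
    (S T : Finset n) (lo hi : ℝ) (hlo : ∀ i ∈ S, lo ≤ φ i) (hhi : ∀ j ∈ T, φ j ≤ hi)
    (g v : n → ℝ) (hg : ∀ j, j ∉ T → g j = 0) (hv : H.mulVec v = g) :
    ∑ i ∈ S, v i ^ 2 ≤ (2 / σ) ^ 2 * Real.exp (-(2 * (lo - hi))) * ∑ j, g j ^ 2 := by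
  refine setDecay_form_op H σ φ hσ hpos (fun w => ?_) S T lo hi hlo hhi g v hg hv
  have h := conjError_lap_add_blocks_ge c hc hc0 blk m hm u hu H hH φ κΔ κQ hκΔ ε hε0 hε hκQ w
  have hww : 0 ≤ w ⬝ᵥ w := by
    simp only [dotProduct]; exact Finset.sum_nonneg fun j _ => mul_self_nonneg _
  nlinarith

/-! ## §4  The lattice shape — the smallness condition does not see the spacing `η` -/

/-- **Set-to-set decay in the lattice shape `Δ^η + aQ*Q` — the all-`η`, (1.114)-type statement.**
`H = lap c + Σ_b m_b u_b ⊗ u_b` with bond coefficients `η⁻²` on at most `z` neighbours, the weight `φ` oscillating by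
`≤ δη ≤ 1` across bonds and by `≤ Θ` on blocks (`Θ ≥ 0`), block strengths `m_b‖u_b‖² ≤ a`, coercivity
`σ‖ω‖² ≤ ⟨ω, Hω⟩`, and `z δ² + a (e^Θ − 1) ≤ σ/2` — a condition in which `η` DOES NOT APPEAR (sibling
`lapDefect_le`, `blockDefect_le`).  Then for `g` supported in `T`, `φ ≤ hi` on `T`, `lo ≤ φ` on `S` and `Hv = g`:
`Σ_{i∈S} v_i² ≤ (2/σ)² e^{−2(lo − hi)} Σ_j g_j²`, i.e. `‖1_S H⁻¹ 1_T‖_{ℓ²→ℓ²} ≤ (2/σ) e^{−(lo − hi)}` for every mesh.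
For the fine torus (`z = 2d`, blocks = unit cubes, `φ = δ·dist(·,T)`, `Θ = δd`, `hi = 0`, `lo = δ·dist(S,T)`) this is
`‖1_S G₀ 1_T‖_{L²(T_η)→L²(T_η)} ≤ (2/σ) e^{−δ·dist(S,T)}` with `(σ, δ)` depending on `(d, a)` only — the `L²`
cube-to-cube decay of `G₀ = (Δ^η + aQ*Q)⁻¹` of the type of [Balaban1984PropagatorsI] (1.114), uniformly in `n`
(the `L^∞` type (1.110) needs a local-regularity input besides; not here). [cite: CombesThomas1973, §II] [folklore] -/
theorem setDecay_lattice [DecidableEq n] {β : Type*} [Fintype β] [DecidableEq β]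
    (c : n → n → ℝ) (hcs : ∀ j k, c j k = c k j) (hc0 : ∀ j k, 0 ≤ c j k)
    (blk : n → β) (m : β → ℝ) (hm : ∀ b, 0 ≤ m b) (u : β → n → ℝ) (hu : ∀ b j, blk j ≠ b → u b j = 0)
    (H : Matrix n n ℝ) (hH : ∀ j k, H j k = lap c j k + ∑ b, m b * (u b j * u b k))
    (σ : ℝ) (hσ : 0 < σ) (hpos : ∀ ω : n → ℝ, σ * (ω ⬝ᵥ ω) ≤ ω ⬝ᵥ H.mulVec ω)
    (φ : n → ℝ) {η δ z a Θ : ℝ} (hη : 0 < η) (h1 : δ * η ≤ 1) (hΘ0 : 0 ≤ Θ)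
    (hc : ∀ j k, c j k ≠ 0 → c j k = (η ^ 2)⁻¹ ∧ |φ j - φ k| ≤ δ * η)
    (hz : ∀ j, ((univ.filter fun k => c j k ≠ 0).card : ℝ) ≤ z)
    (hΘ : ∀ j k, blk j = blk k → |φ j - φ k| ≤ Θ)
    (ha : ∀ b, m b * ∑ k, u b k ^ 2 ≤ a)
    (hsmall : z * δ ^ 2 + a * (Real.exp Θ - 1) ≤ σ / 2)
    (S T : Finset n) (lo hi : ℝ) (hlo : ∀ i ∈ S, lo ≤ φ i) (hhi : ∀ j ∈ T, φ j ≤ hi)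
    (g v : n → ℝ) (hg : ∀ j, j ∉ T → g j = 0) (hv : H.mulVec v = g) :
    ∑ i ∈ S, v i ^ 2 ≤ (2 / σ) ^ 2 * Real.exp (-(2 * (lo - hi))) * ∑ j, g j ^ 2 := by
  have hε0 : 0 ≤ Real.exp Θ - 1 := by linarith [Real.add_one_le_exp Θ]
  refine setDecay_lap_add_blocks c hcs hc0 blk m hm u hu H hH σ hσ hpos φ (z * δ ^ 2)
    (a * (Real.exp Θ - 1)) (lapDefect_le c φ hη h1 hc hz) (fun _ => Real.exp Θ - 1) (fun _ => hε0)
    (fun b j k hj hk => blockDefect_le blk φ Θ hΘ b j k hj hk) (fun b => ?_) hsmall S T lo hi hlo hhi g v hg hv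
  calc m b * (Real.exp Θ - 1) * ∑ k, u b k ^ 2 = (Real.exp Θ - 1) * (m b * ∑ k, u b k ^ 2) := by ring
    _ ≤ (Real.exp Θ - 1) * a := mul_le_mul_of_nonneg_left (ha b) hε0
    _ = a * (Real.exp Θ - 1) := mul_comm _ _

/-! ## §5  The distance-to-the-source weight (so that an instantiator supplies only metric facts) -/

/-- Distance from `j` to a nonempty set `T` along a (pseudo-)distance function `d`. [folklore] -/
def distTo (d : n → n → ℝ) (T : Finset n) (hT : T.Nonempty) (j : n) : ℝ := T.inf' hT fun t => d j t

omit [Fintype n] in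
/-- `distTo ≤` the distance to any point of the source set. [folklore] -/
theorem distTo_le (d : n → n → ℝ) (T : Finset n) (hT : T.Nonempty) {j t : n} (ht : t ∈ T) :
    distTo d T hT j ≤ d j t :=
  Finset.inf'_le _ ht

omit [Fintype n] in
/-- A common lower bound of the distances to the source set bounds `distTo` from below. [folklore] -/
theorem le_distTo (d : n → n → ℝ) (T : Finset n) (hT : T.Nonempty) {j : n} {r : ℝ}
    (h : ∀ t ∈ T, r ≤ d j t) : r ≤ distTo d T hT j :=
  Finset.le_inf' hT _ h

omit [Fintype n] in
/-- On the source set the weight is `≤ 0` (it is `0` for a genuine pseudo-metric). [folklore] -/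
theorem distTo_le_zero_of_mem (d : n → n → ℝ) (hd0 : ∀ i, d i i = 0) (T : Finset n) (hT : T.Nonempty)
    {j : n} (hj : j ∈ T) : distTo d T hT j ≤ 0 := by
  have := distTo_le d T hT (j := j) hj
  rwa [hd0] at this

omit [Fintype n] in
/-- `distTo` is `1`-Lipschitz for `d`: `|distTo j − distTo k| ≤ d j k` (triangle inequality and symmetry).
[folklore] -/
theorem abs_distTo_sub_le (d : n → n → ℝ) (hds : ∀ i j, d i j = d j i)
    (hdt : ∀ i j k, d i k ≤ d i j + d j k) (T : Finset n) (hT : T.Nonempty) (j k : n) :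
    |distTo d T hT j - distTo d T hT k| ≤ d j k := by
  have one : ∀ j k : n, distTo d T hT j ≤ d j k + distTo d T hT k := by
    intro j k
    obtain ⟨t, ht, hmin⟩ := Finset.exists_mem_eq_inf' hT fun t => d k t
    have hk : distTo d T hT k = d k t := hmin
    calc distTo d T hT j ≤ d j t := distTo_le d T hT ht
      _ ≤ d j k + d k t := hdt j k t
      _ = d j k + distTo d T hT k := by rw [hk]
  rw [abs_sub_le_iff]
  constructor
  · linarith [one j k]
  · linarith [one k j, hds j k]

/-- **Set-to-set decay in the lattice shape, metric form.**  As `setDecay_lattice`, with the weight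
`φ = δ · distTo d T` built in: the instantiator supplies a distance function `d` (zero diagonal, symmetric, triangle
inequality), bonds of `d`-length `≤ η` carrying the coefficient `η⁻²` (at most `z` per site), blocks of `d`-diameter
`≤ D`, block strengths `m_b‖u_b‖² ≤ a`, coercivity `σ`, `0 ≤ δ`, `δη ≤ 1` and the `η`-free smallness
`z δ² + a (e^{δD} − 1) ≤ σ/2`; conclusion: for `g` supported in `T` (nonempty) and `S` at `d`-distance `≥ R` from `T`,
`Σ_{i∈S} (H⁻¹g)_i² ≤ (2/σ)² e^{−2δR} Σ_j g_j²`, i.e. `‖1_S H⁻¹ 1_T‖_{ℓ²→ℓ²} ≤ (2/σ) e^{−δR}` — for the fine torus,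
`‖1_S G₀ 1_T‖_{L²(T_η)→L²(T_η)} ≤ (2/σ) e^{−δ·dist(S,T)}` for every mesh. [cite: CombesThomas1973, §II] [folklore] -/
theorem setDecay_lattice_dist [DecidableEq n] {β : Type*} [Fintype β] [DecidableEq β]
    (c : n → n → ℝ) (hcs : ∀ j k, c j k = c k j) (hc0 : ∀ j k, 0 ≤ c j k)
    (blk : n → β) (m : β → ℝ) (hm : ∀ b, 0 ≤ m b) (u : β → n → ℝ) (hu : ∀ b j, blk j ≠ b → u b j = 0)
    (H : Matrix n n ℝ) (hH : ∀ j k, H j k = lap c j k + ∑ b, m b * (u b j * u b k))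
    (σ : ℝ) (hσ : 0 < σ) (hpos : ∀ ω : n → ℝ, σ * (ω ⬝ᵥ ω) ≤ ω ⬝ᵥ H.mulVec ω)
    (d : n → n → ℝ) (hd0 : ∀ i, d i i = 0) (hds : ∀ i j, d i j = d j i)
    (hdt : ∀ i j k, d i k ≤ d i j + d j k)
    {η δ z a D : ℝ} (hη : 0 < η) (hδ : 0 ≤ δ) (h1 : δ * η ≤ 1) (hD : 0 ≤ D)
    (hc : ∀ j k, c j k ≠ 0 → c j k = (η ^ 2)⁻¹ ∧ d j k ≤ η)
    (hz : ∀ j, ((univ.filter fun k => c j k ≠ 0).card : ℝ) ≤ z)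
    (hblk : ∀ j k, blk j = blk k → d j k ≤ D)
    (ha : ∀ b, m b * ∑ k, u b k ^ 2 ≤ a)
    (hsmall : z * δ ^ 2 + a * (Real.exp (δ * D) - 1) ≤ σ / 2)
    (S T : Finset n) (hT : T.Nonempty) (R : ℝ) (hR : ∀ i ∈ S, ∀ t ∈ T, R ≤ d i t)
    (g v : n → ℝ) (hg : ∀ j, j ∉ T → g j = 0) (hv : H.mulVec v = g) :
    ∑ i ∈ S, v i ^ 2 ≤ (2 / σ) ^ 2 * Real.exp (-(2 * (δ * R))) * ∑ j, g j ^ 2 := by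
  set φ : n → ℝ := fun j => δ * distTo d T hT j with hφ
  have hlip : ∀ j k, |φ j - φ k| ≤ δ * d j k := by
    intro j k
    simp only [hφ]
    rw [← mul_sub, abs_mul, abs_of_nonneg hδ]
    exact mul_le_mul_of_nonneg_left (abs_distTo_sub_le d hds hdt T hT j k) hδ
  have h := setDecay_lattice c hcs hc0 blk m hm u hu H hH σ hσ hpos φ (η := η) (δ := δ) (z := z) (a := a)
    (Θ := δ * D) hη h1 (mul_nonneg hδ hD)
    (fun j k hjk => ⟨(hc j k hjk).1, (hlip j k).trans (mul_le_mul_of_nonneg_left (hc j k hjk).2 hδ)⟩)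
    hz (fun j k hjk => (hlip j k).trans (mul_le_mul_of_nonneg_left (hblk j k hjk) hδ)) ha hsmall
    S T (δ * R) 0
    (fun i hi => mul_le_mul_of_nonneg_left (le_distTo d T hT fun t ht => hR i hi t ht) hδ)
    (fun j hj => mul_nonpos_iff.2 (Or.inl ⟨hδ, distTo_le_zero_of_mem d hd0 T hT hj⟩))
    g v hg hv
  simpa using h

/-- The sibling's point-source bound is the special case `S = {i}`, `T = {k₀}`, `g = e_{k₀}` of the set-to-set bound:
from `Σ_{i'∈{i}} v_{i'}² ≤ (2/σ)² e^{−2(φ_i − φ_{k₀})} Σ_j (e_{k₀})_j²` one reads off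
`|v_i| ≤ (2/σ) e^{−(φ_i − φ_{k₀})}`. [folklore] -/
theorem pointwise_of_setDecay [DecidableEq n] (σ : ℝ) (hσ : 0 < σ) (φ v : n → ℝ) (i k₀ : n)
    (h : ∑ i' ∈ ({i} : Finset n), v i' ^ 2 ≤
      (2 / σ) ^ 2 * Real.exp (-(2 * (φ i - φ k₀))) * ∑ j, (Pi.single k₀ (1 : ℝ) : n → ℝ) j ^ 2) :
    |v i| ≤ 2 / σ * Real.exp (-(φ i - φ k₀)) := by
  have hsum : ∑ j, (Pi.single k₀ (1 : ℝ) : n → ℝ) j ^ 2 = 1 := by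
    rw [Finset.sum_eq_single k₀]
    · simp
    · intro j _ hj; simp [hj]
    · intro hk; exact absurd (Finset.mem_univ _) hk
  rw [Finset.sum_singleton, hsum, mul_one] at h
  have h0 : 0 ≤ 2 / σ * Real.exp (-(φ i - φ k₀)) := by positivity
  have hsq : v i ^ 2 ≤ (2 / σ * Real.exp (-(φ i - φ k₀))) ^ 2 := by
    calc v i ^ 2 ≤ (2 / σ) ^ 2 * Real.exp (-(2 * (φ i - φ k₀))) := h
      _ = (2 / σ * Real.exp (-(φ i - φ k₀))) ^ 2 := by
          rw [mul_pow, ← Real.exp_nat_mul]; push_cast; ring_nf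
  exact abs_le.2 (abs_le_of_sq_le_sq' hsq h0)

/-- Sanity instance (checks that the operator form is not vacuous and the constants are as stated): on the one-point
index set with `H = (1)`, `σ = 1`, `φ = 0`, the hypotheses hold and `combesThomas_form_op` gives `v² ≤ 4 g²`. -/
example (g v : Fin 1 → ℝ) (hv : (1 : Matrix (Fin 1) (Fin 1) ℝ).mulVec v = g) :
    ∑ j, (Real.exp ((fun _ => (0 : ℝ)) j) * v j) ^ 2 ≤
      (2 / 1) ^ 2 * ∑ j, (Real.exp ((fun _ => (0 : ℝ)) j) * g j) ^ 2 := by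
  refine combesThomas_form_op (1 : Matrix (Fin 1) (Fin 1) ℝ) 1 (fun _ => 0) one_pos ?_ ?_ g v hv
  · intro ω; simp
  · intro w
    simp only [sub_self, Real.exp_zero, zero_mul, Finset.sum_const_zero]
    have : 0 ≤ w ⬝ᵥ w := by
      simp only [dotProduct]; exact Finset.sum_nonneg fun j _ => mul_self_nonneg _
    linarith

end Literature.MathematicalPhysics.QuantumFieldTheory.Balaban1983to89.Beta.CombesThomasFormOp
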